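import Summits.ValiantsHypothesis.ValiantsHypothesis.Theorems.KPlusLogSqLawTridiagonalRealStaticJoin

/-!
# Route «KPlusLogSqLaw», crux `WeakLifting` (stmt-ValiantsHypothesis-19561) — REAL side of the tridiagonal sector:
# the GLUE LAW — two certified blocks with SEPARATED clusters, joined by one steep link, keep both rows and gain a transition
# (`B(m₁ + m₂) ≥ Z₁ + Z₂ + 1`: the α register is superadditive, all sizes)

HONEST FRAMING.  Helper (`--supports stmt-ValiantsHypothesis-19561 --as helper`), seat val-sym-lift-p3 (g14), cell `pub-symmetroid`, 2026-08-28,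
α register (static definite symmetric tridiagonal monomial designs), LOWER side.  The doubling and join laws (`…Doubling`, `…DoublingSharp`,
`…Join`) glue a block to ITS OWN mirror image and rest on reversal symmetry.  This file glues two ARBITRARY certified blocks: block 1 =
`(a₁, d₁, b₁, f₁)` of size `n₁ + 1` (`N₁ = D_{n₁+1}`, `N₁⁻ = D_{n₁}`), block 2 = `(a₂, d₂, b₂, f₂)` of size `n₂ + 1` (`N₂`; `C₂` = block 2 minus its
FIRST vertex), joined by one link `β X^F` between the last vertex of block 1 and the first vertex of block 2 (continuant currency `pathDet`):
* `pathDet_glue` — the glued design of size `n₁ + n₂ + 2` has determinant `N₁ · N₂ − β² X^{2F} · N₁⁻ · C₂` (two-sided splitting);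
* `eval_pathDet_rescale` — RESCALING `x ↦ λ x` is a change of design (coefficients `a t · λ^{d t}`, `b t · λ^{f t}`), so a certified cluster can be
  moved away from another block's cluster;
* `le_card_roots_window_of_isChain` — WINDOWED alternation count (`|l|` roots of `P` inside `(x, hi)` from an alternation along `x :: l ≤ hi`);
* `glue_row` — THE GLUE LAW (sign-only): if `p = N₁ · N₂` alternates along a cluster `x₂ :: l₂` of positive points and along a cluster
  `x₁ :: l₁ ++ [ρ]` above it, keeps its sign from `ρ` to a further point `σ`, and agrees in sign with `q = N₁⁻ · C₂` at `σ`, then for a steep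
  coupling exponent `F` and some `β > 0` the glued determinant `p − β² x^{2F} q` copies the sign of `p` on both clusters and of `−q` at `σ`
  (lift-p1's `exists_move_signs_sq`), hence has at least `|l₂| + |l₁| + 2 = Z₂ + Z₁ + 1` distinct positive zeros — **`B(m₁ + m₂) ≥ Z₁ + Z₂ + 1`**;
  `glue_row_noTransition`: `Z₁ + Z₂` without the two sign hypotheses at `σ`.  (A certificate for `N₂` on points where `N₁` has constant sign
  `s` is a certificate for `N₁ · N₂`: `isChain_alt_congr` with `c = s`.)
Nothing here is an upper bound; nothing bears on `WeakLifting` / `TropicalB` (stmt-19771) in their windows, Conjecture B, the Door-A registers,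
`MatrixDescartes` (stmt-ValiantsHypothesis-18050) or VP ≠ VNP.
[mechanism: this seat; folklore: continuants, intermediate values; lift-p1 g11's `exists_move_signs_sq`]
-/


-- `Summit.ValiantsHypothesis.ValiantsHypothesis.…` repeats a component by the D-0017 layout (single-conjunct summit); the name is mandated.
set_option linter.dupNamespace false
set_option autoImplicit false

namespace Summit.ValiantsHypothesis.ValiantsHypothesis.Theorems.KPlusLogSqLaw.StaticTridiagonalRealGlue

open Polynomial
open Summit.ValiantsHypothesis.ValiantsHypothesis.Theorems.KPlusLogSqLaw.StaticTridiagonalRealPotential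
  (pathDet pathDet_congr pathDet_zero pathDet_one pathDet_add_two)
open Summit.ValiantsHypothesis.ValiantsHypothesis.Theorems.KPlusLogSqLaw.StaticTridiagonalRealCut (pathDet_split_two_sided)
open Summit.ValiantsHypothesis.ValiantsHypothesis.Theorems.KPlusLogSqLaw.StaticTridiagonalRealLadder
  (exists_move_signs_sq ne_zero_of_isChain_alt lt_last_of_isChain isChain_alt_congr)

/-! ### §1 The glued design and rescaling -/

section Glue

variable (a₁ : ℕ → ℝ) (d₁ : ℕ → ℕ) (b₁ : ℕ → ℝ) (f₁ : ℕ → ℕ) (a₂ : ℕ → ℝ) (d₂ : ℕ → ℕ) (b₂ : ℕ → ℝ) (f₂ : ℕ → ℕ)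

/-- **The glued design.**  Block 1 on the vertices `0..n₁`, block 2 on the vertices `n₁+1..n₁+n₂+1`, one coupling link `β X^F` at `t = n₁`.
Its determinant is `N₁ · N₂ − β² X^{2F} · N₁⁻ · C₂` (`N₁⁻` = block 1 minus its last vertex, `C₂` = block 2 minus its first vertex).
[folklore: continuants] -/
theorem pathDet_glue (n₁ n₂ : ℕ) (β : ℝ) (F : ℕ) :
    pathDet (fun t => if t ≤ n₁ then a₁ t else a₂ (t - (n₁ + 1))) (fun t => if t ≤ n₁ then d₁ t else d₂ (t - (n₁ + 1)))
        (fun t => if t < n₁ then b₁ t else if t = n₁ then β else b₂ (t - (n₁ + 1)))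
        (fun t => if t < n₁ then f₁ t else if t = n₁ then F else f₂ (t - (n₁ + 1))) (n₁ + n₂ + 2) =
      pathDet a₁ d₁ b₁ f₁ (n₁ + 1) * pathDet a₂ d₂ b₂ f₂ (n₂ + 1) -
        C (β ^ 2) * X ^ (2 * F) * pathDet a₁ d₁ b₁ f₁ n₁ *
          pathDet (fun t => a₂ (t + 1)) (fun t => d₂ (t + 1)) (fun t => b₂ (t + 1)) (fun t => f₂ (t + 1)) n₂ := by
  rw [show n₁ + n₂ + 2 = n₁ + 2 + n₂ by ring, pathDet_split_two_sided]
  have h1 : pathDet (fun t => if t ≤ n₁ then a₁ t else a₂ (t - (n₁ + 1))) (fun t => if t ≤ n₁ then d₁ t else d₂ (t - (n₁ + 1)))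
      (fun t => if t < n₁ then b₁ t else if t = n₁ then β else b₂ (t - (n₁ + 1)))
      (fun t => if t < n₁ then f₁ t else if t = n₁ then F else f₂ (t - (n₁ + 1))) (n₁ + 1) = pathDet a₁ d₁ b₁ f₁ (n₁ + 1) :=
    pathDet_congr (fun t ht => by rw [if_pos (by omega)]) (fun t ht => by rw [if_pos (by omega)])
      (fun t ht => by rw [if_pos (by omega)]) (fun t ht => by rw [if_pos (by omega)])
  have h0 : pathDet (fun t => if t ≤ n₁ then a₁ t else a₂ (t - (n₁ + 1))) (fun t => if t ≤ n₁ then d₁ t else d₂ (t - (n₁ + 1)))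
      (fun t => if t < n₁ then b₁ t else if t = n₁ then β else b₂ (t - (n₁ + 1)))
      (fun t => if t < n₁ then f₁ t else if t = n₁ then F else f₂ (t - (n₁ + 1))) n₁ = pathDet a₁ d₁ b₁ f₁ n₁ :=
    pathDet_congr (fun t ht => by rw [if_pos (by omega)]) (fun t ht => by rw [if_pos (by omega)])
      (fun t ht => by rw [if_pos (by omega)]) (fun t ht => by rw [if_pos (by omega)])
  have h2 : pathDet (fun t => (fun t => if t ≤ n₁ then a₁ t else a₂ (t - (n₁ + 1))) (t + (n₁ + 1)))
      (fun t => (fun t => if t ≤ n₁ then d₁ t else d₂ (t - (n₁ + 1))) (t + (n₁ + 1)))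
      (fun t => (fun t => if t < n₁ then b₁ t else if t = n₁ then β else b₂ (t - (n₁ + 1))) (t + (n₁ + 1)))
      (fun t => (fun t => if t < n₁ then f₁ t else if t = n₁ then F else f₂ (t - (n₁ + 1))) (t + (n₁ + 1))) (n₂ + 1) =
      pathDet a₂ d₂ b₂ f₂ (n₂ + 1) := by
    refine pathDet_congr (fun t ht => ?_) (fun t ht => ?_) (fun t ht => ?_) (fun t ht => ?_) <;> simp only <;>
      split_ifs <;> first | (exfalso; omega) | rw [show t + (n₁ + 1) - (n₁ + 1) = t by omega]
  have h3 : pathDet (fun t => (fun t => if t ≤ n₁ then a₁ t else a₂ (t - (n₁ + 1))) (t + (n₁ + 2)))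
      (fun t => (fun t => if t ≤ n₁ then d₁ t else d₂ (t - (n₁ + 1))) (t + (n₁ + 2)))
      (fun t => (fun t => if t < n₁ then b₁ t else if t = n₁ then β else b₂ (t - (n₁ + 1))) (t + (n₁ + 2)))
      (fun t => (fun t => if t < n₁ then f₁ t else if t = n₁ then F else f₂ (t - (n₁ + 1))) (t + (n₁ + 2))) n₂ =
      pathDet (fun t => a₂ (t + 1)) (fun t => d₂ (t + 1)) (fun t => b₂ (t + 1)) (fun t => f₂ (t + 1)) n₂ := by
    refine pathDet_congr (fun t ht => ?_) (fun t ht => ?_) (fun t ht => ?_) (fun t ht => ?_) <;> simp only <;>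
      split_ifs <;> first | (exfalso; omega) | rw [show t + (n₁ + 2) - (n₁ + 1) = t + 1 by omega]
  rw [h1, h0, h2, h3,
    show (if n₁ < n₁ then b₁ n₁ else if n₁ = n₁ then β else b₂ (n₁ - (n₁ + 1))) = β by simp,
    show (if n₁ < n₁ then f₁ n₁ else if n₁ = n₁ then F else f₂ (n₁ - (n₁ + 1))) = F by simp,
    map_pow, mul_pow, ← pow_mul, mul_comm F 2]

/-- The glued determinant at a real point. [folklore] -/
theorem eval_pathDet_glue (n₁ n₂ : ℕ) (β : ℝ) (F : ℕ) (x : ℝ) :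
    (pathDet (fun t => if t ≤ n₁ then a₁ t else a₂ (t - (n₁ + 1))) (fun t => if t ≤ n₁ then d₁ t else d₂ (t - (n₁ + 1)))
        (fun t => if t < n₁ then b₁ t else if t = n₁ then β else b₂ (t - (n₁ + 1)))
        (fun t => if t < n₁ then f₁ t else if t = n₁ then F else f₂ (t - (n₁ + 1))) (n₁ + n₂ + 2)).eval x =
      (pathDet a₁ d₁ b₁ f₁ (n₁ + 1)).eval x * (pathDet a₂ d₂ b₂ f₂ (n₂ + 1)).eval x -
        β ^ 2 * x ^ (2 * F) * ((pathDet a₁ d₁ b₁ f₁ n₁).eval x *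
          (pathDet (fun t => a₂ (t + 1)) (fun t => d₂ (t + 1)) (fun t => b₂ (t + 1)) (fun t => f₂ (t + 1)) n₂).eval x) := by
  rw [pathDet_glue]
  simp only [eval_sub, eval_mul, eval_C, eval_pow, eval_X]
  ring

end Glue

/-- **Rescaling is a change of design.**  Multiplying the coefficients `a t`, `b t` by `λ^{d t}`, `λ^{f t}` gives the continuants
`x ↦ D_k(λ · x)`. [folklore] -/
theorem eval_pathDet_rescale (a : ℕ → ℝ) (d : ℕ → ℕ) (b : ℕ → ℝ) (f : ℕ → ℕ) (lam x : ℝ) :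
    ∀ k : ℕ, (pathDet (fun t => a t * lam ^ d t) d (fun t => b t * lam ^ f t) f k).eval x = (pathDet a d b f k).eval (lam * x) := by
  -- two-step induction on `k`
  have key : ∀ k : ℕ,
      (pathDet (fun t => a t * lam ^ d t) d (fun t => b t * lam ^ f t) f k).eval x = (pathDet a d b f k).eval (lam * x) ∧
      (pathDet (fun t => a t * lam ^ d t) d (fun t => b t * lam ^ f t) f (k + 1)).eval x =
        (pathDet a d b f (k + 1)).eval (lam * x) := by
    intro k
    induction k with
    | zero =>
      refine ⟨by rw [pathDet_zero, pathDet_zero, eval_one, eval_one], ?_⟩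
      rw [zero_add, pathDet_one, pathDet_one]
      simp only [eval_mul, eval_C, eval_pow, eval_X, mul_pow]
      ring
    | succ k ih =>
      refine ⟨ih.2, ?_⟩
      rw [show k + 1 + 1 = k + 2 by ring, pathDet_add_two, pathDet_add_two]
      simp only [eval_sub, eval_mul, eval_C, eval_pow, eval_X, ih.1, ih.2, mul_pow]
      ring
  exact fun k => (key k).1

/-! ### §2 Windowed alternation counts -/

/-- **Windowed alternation count.**  If `P` alternates in sign along a strictly increasing list `x :: l` whose points are `≤ hi`, then `P` has
at least `|l|` distinct roots in the open window `(x, hi)`. [folklore: intermediate values] -/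
theorem le_card_roots_window_of_isChain (P : ℝ[X]) (hi : ℝ) :
    ∀ (l : List ℝ) (x : ℝ), (x :: l).IsChain (· < ·) → (∀ v ∈ l, v ≤ hi) →
      (x :: l).IsChain (fun u v => P.eval u * P.eval v < 0) →
      l.length ≤ (P.roots.toFinset.filter (fun t => x < t ∧ t < hi)).card := by
  intro l
  induction l with
  | nil => intro x _ _ _; simp
  | cons y l ih =>
    intro x hlt hhi halt
    have hxy : x < y := (List.isChain_cons_cons.mp hlt).1
    have hPxy : P.eval x * P.eval y < 0 := (List.isChain_cons_cons.mp halt).1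
    have hP : P ≠ 0 := fun h0 => by rw [h0, eval_zero, zero_mul] at hPxy; exact lt_irrefl _ hPxy
    -- a root strictly between `x` and `y`
    obtain ⟨r, hr, hPr⟩ : ∃ r ∈ Set.Ioo x y, P.eval r = 0 := by
      have hc : ContinuousOn (fun t => P.eval t) (Set.Icc x y) := (Polynomial.continuous P).continuousOn
      rcases mul_neg_iff.mp hPxy with ⟨h1, h2⟩ | ⟨h1, h2⟩
      · exact intermediate_value_Ioo' hxy.le hc ⟨h2, h1⟩
      · exact intermediate_value_Ioo hxy.le hc ⟨h1, h2⟩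
    have hyhi : y ≤ hi := hhi y (by simp)
    -- the tail gives `|l|` roots in `(y, hi)`, all different from `r < y`
    have ih' := ih y (List.isChain_cons_cons.mp hlt).2 (fun v hv => hhi v (List.mem_cons_of_mem _ hv))
      (List.isChain_cons_cons.mp halt).2
    have hsub : insert r (P.roots.toFinset.filter (fun t => y < t ∧ t < hi)) ⊆
        P.roots.toFinset.filter (fun t => x < t ∧ t < hi) := by
      intro t ht
      rcases Finset.mem_insert.mp ht with rfl | ht
      · rw [Finset.mem_filter, Multiset.mem_toFinset, mem_roots hP]
        exact ⟨hPr, hr.1, hr.2.trans_le hyhi⟩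
      · rw [Finset.mem_filter] at ht ⊢
        exact ⟨ht.1, hxy.trans ht.2.1, ht.2.2⟩
    have hnot : r ∉ P.roots.toFinset.filter (fun t => y < t ∧ t < hi) := fun h =>
      lt_asymm (Finset.mem_filter.mp h).2.1 hr.2
    have := Finset.card_le_card hsub
    rw [Finset.card_insert_of_notMem hnot] at this
    simp only [List.length_cons]
    omega

/-! ### §3 The glue law -/

section GlueRow

variable (a₁ : ℕ → ℝ) (d₁ : ℕ → ℕ) (b₁ : ℕ → ℝ) (f₁ : ℕ → ℕ) (a₂ : ℕ → ℝ) (d₂ : ℕ → ℕ) (b₂ : ℕ → ℝ) (f₂ : ℕ → ℕ)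

/-- **THE GLUE LAW (superadditivity with a transition, all sizes).**  Blocks 1 and 2 of sizes `n₁ + 1`, `n₂ + 1`; `p = N₁ · N₂`,
`q = N₁⁻ · C₂` (as in `pathDet_glue`).  Suppose `p` alternates in sign along the positive points `x₂ :: l₂` (block 2's cluster) and along
`x₁ :: l₁ ++ [ρ]` (block 1's cluster), all strictly increasing with `x₂ :: l₂` below `x₁`, that `p(ρ) · p(σ) > 0` for a further point `σ > ρ`, and
that `p(σ) · q(σ) > 0`.  Then for some coupling exponent `F` and some `β > 0` the glued design of size `n₁ + n₂ + 2` has at least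
`|l₂| + |l₁| + 2 = Z₂ + Z₁ + 1` distinct positive determinant zeros (`|l₂|` in the window `(x₂, x₁)`, `|l₁| + 2` in the window `(x₁, σ)`).
**`B(m₁ + m₂) ≥ Z₁ + Z₂ + 1`.** [this seat] -/
theorem glue_row (n₁ n₂ : ℕ) (x₂ : ℝ) (l₂ : List ℝ) (hl₂ : l₂ ≠ []) (x₁ : ℝ) (l₁ : List ℝ) (ρ σ : ℝ)
    (hchain : (x₂ :: l₂ ++ x₁ :: (l₁ ++ [ρ, σ])).IsChain (· < ·)) (hx₂ : 0 < x₂)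
    (halt₂ : (x₂ :: l₂).IsChain (fun x y =>
      ((pathDet a₁ d₁ b₁ f₁ (n₁ + 1)).eval x * (pathDet a₂ d₂ b₂ f₂ (n₂ + 1)).eval x) *
        ((pathDet a₁ d₁ b₁ f₁ (n₁ + 1)).eval y * (pathDet a₂ d₂ b₂ f₂ (n₂ + 1)).eval y) < 0))
    (halt₁ : (x₁ :: (l₁ ++ [ρ])).IsChain (fun x y =>
      ((pathDet a₁ d₁ b₁ f₁ (n₁ + 1)).eval x * (pathDet a₂ d₂ b₂ f₂ (n₂ + 1)).eval x) *
        ((pathDet a₁ d₁ b₁ f₁ (n₁ + 1)).eval y * (pathDet a₂ d₂ b₂ f₂ (n₂ + 1)).eval y) < 0))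
    (hρσ : 0 < ((pathDet a₁ d₁ b₁ f₁ (n₁ + 1)).eval ρ * (pathDet a₂ d₂ b₂ f₂ (n₂ + 1)).eval ρ) *
      ((pathDet a₁ d₁ b₁ f₁ (n₁ + 1)).eval σ * (pathDet a₂ d₂ b₂ f₂ (n₂ + 1)).eval σ))
    (hagree : 0 < ((pathDet a₁ d₁ b₁ f₁ (n₁ + 1)).eval σ * (pathDet a₂ d₂ b₂ f₂ (n₂ + 1)).eval σ) *
      ((pathDet a₁ d₁ b₁ f₁ n₁).eval σ *
        (pathDet (fun t => a₂ (t + 1)) (fun t => d₂ (t + 1)) (fun t => b₂ (t + 1)) (fun t => f₂ (t + 1)) n₂).eval σ)) :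
    ∃ (F : ℕ) (β : ℝ), 0 < β ∧ l₂.length + l₁.length + 2 ≤
      ((pathDet (fun t => if t ≤ n₁ then a₁ t else a₂ (t - (n₁ + 1))) (fun t => if t ≤ n₁ then d₁ t else d₂ (t - (n₁ + 1)))
        (fun t => if t < n₁ then b₁ t else if t = n₁ then β else b₂ (t - (n₁ + 1)))
        (fun t => if t < n₁ then f₁ t else if t = n₁ then F else f₂ (t - (n₁ + 1))) (n₁ + n₂ + 2)).roots.toFinset.filter
          (fun t => 0 < t)).card := by
  -- abbreviations
  set p : ℝ → ℝ := fun x => (pathDet a₁ d₁ b₁ f₁ (n₁ + 1)).eval x * (pathDet a₂ d₂ b₂ f₂ (n₂ + 1)).eval x with hp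
  set q : ℝ → ℝ := fun x => (pathDet a₁ d₁ b₁ f₁ n₁).eval x *
    (pathDet (fun t => a₂ (t + 1)) (fun t => d₂ (t + 1)) (fun t => b₂ (t + 1)) (fun t => f₂ (t + 1)) n₂).eval x with hq
  change (x₂ :: l₂).IsChain (fun x y => p x * p y < 0) at halt₂
  change (x₁ :: (l₁ ++ [ρ])).IsChain (fun x y => p x * p y < 0) at halt₁
  change 0 < p ρ * p σ at hρσ
  change 0 < p σ * q σ at hagree
  -- order facts from the big chain
  have hpw : (x₂ :: l₂ ++ x₁ :: (l₁ ++ [ρ, σ])).Pairwise (· < ·) := List.isChain_iff_pairwise.mp hchain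
  have hch1 : (x₁ :: (l₁ ++ [ρ, σ])).IsChain (· < ·) := (List.isChain_split.mp hchain).2
  have hch2 : (x₂ :: (l₂ ++ [x₁])).IsChain (· < ·) := (List.isChain_split.mp hchain).1
  have hl₂x₁ : ∀ v ∈ l₂, v < x₁ := fun v hv =>
    lt_last_of_isChain (show ((x₂ :: l₂) ++ [x₁]).IsChain (· < ·) from hch2) v (List.mem_cons_of_mem _ hv)
  have hx₂x₁ : x₂ < x₁ := lt_last_of_isChain (show ((x₂ :: l₂) ++ [x₁]).IsChain (· < ·) from hch2) x₂ (by simp)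
  have hch1' := List.isChain_cons_split.mp hch1
  have hρσ' : ρ < σ := (List.isChain_cons_cons.mp hch1'.2).1
  have hbelowρ : ∀ v ∈ x₁ :: l₁, v < ρ := fun v hv =>
    lt_last_of_isChain (show ((x₁ :: l₁) ++ [ρ]).IsChain (· < ·) from hch1'.1) v hv
  have hx₁ρ : x₁ ≤ ρ := (hbelowρ x₁ (by simp)).le
  have hx₁ : 0 < x₁ := hx₂.trans hx₂x₁
  have hρ : 0 < ρ := hx₁.trans_le hx₁ρ
  -- `p ≠ 0` at the certificate points
  have hρ0 : p ρ ≠ 0 := fun h0 => by rw [h0, zero_mul] at hρσ; exact lt_irrefl _ hρσ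
  have hqσ : q σ ≠ 0 := fun h0 => by rw [h0, mul_zero] at hagree; exact lt_irrefl _ hagree
  have hpne₂ : ∀ v ∈ x₂ :: l₂, p v ≠ 0 := by
    obtain ⟨y, l, rfl⟩ := List.exists_cons_of_ne_nil hl₂
    exact ne_zero_of_isChain_alt halt₂
  have hpne₁ : ∀ v ∈ x₁ :: (l₁ ++ [ρ]), p v ≠ 0 := by
    rcases l₁ with _ | ⟨y, l₁⟩
    · intro v hv
      simp only [List.nil_append, List.mem_cons, List.not_mem_nil, or_false] at hv
      rcases hv with rfl | rfl
      · exact ne_zero_of_isChain_alt halt₁ v (by simp)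
      · exact hρ0
    · exact ne_zero_of_isChain_alt halt₁
  -- lift-p1's finite-slope move: `D = p − κ x^{2F} q` has the sign of `p` on both clusters and of `−q` at `σ`
  obtain ⟨F, κ, hκ, hxs, hys⟩ := exists_move_signs_sq p q (x₂ :: l₂ ++ x₁ :: (l₁ ++ [ρ])).toFinset {σ} hρ hρσ'
    (fun x hx => by
      have hx' : x ∈ x₂ :: l₂ ++ x₁ :: (l₁ ++ [ρ]) := List.mem_toFinset.mp hx
      rcases List.mem_append.mp hx' with h2 | h1
      · have hlt : x < x₁ := by
          rcases List.mem_cons.mp h2 with rfl | h2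
          · exact hx₂x₁
          · exact hl₂x₁ x h2
        refine ⟨?_, (hlt.trans_le hx₁ρ).le, hpne₂ x h2⟩
        rcases List.mem_cons.mp h2 with rfl | h2
        · exact hx₂
        · exact hx₂.trans (List.rel_of_pairwise_cons hpw (List.mem_append_left _ h2))
      · have hxρ : x ≤ ρ := by
          rcases List.mem_cons.mp h1 with rfl | h1
          · exact hx₁ρ
          · rcases List.mem_append.mp h1 with h | h
            · exact (hbelowρ x (List.mem_cons_of_mem _ h)).le
            · simp only [List.mem_singleton] at h; rw [h]
        have hx₁x : x₁ ≤ x := by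
          rcases List.mem_cons.mp h1 with rfl | h1
          · exact le_rfl
          · exact (List.rel_of_pairwise_cons (List.isChain_iff_pairwise.mp hch1'.1) h1).le
        exact ⟨hx₁.trans_le hx₁x, hxρ, hpne₁ x h1⟩)
    (fun y hy => by
      rw [Finset.mem_singleton] at hy
      subst hy
      exact ⟨le_rfl, hqσ⟩)
  refine ⟨F, Real.sqrt κ, Real.sqrt_pos.mpr hκ, ?_⟩
  -- the glued determinant is `D`
  set G := pathDet (fun t => if t ≤ n₁ then a₁ t else a₂ (t - (n₁ + 1))) (fun t => if t ≤ n₁ then d₁ t else d₂ (t - (n₁ + 1)))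
      (fun t => if t < n₁ then b₁ t else if t = n₁ then Real.sqrt κ else b₂ (t - (n₁ + 1)))
      (fun t => if t < n₁ then f₁ t else if t = n₁ then F else f₂ (t - (n₁ + 1))) (n₁ + n₂ + 2) with hG
  have hev : ∀ x : ℝ, G.eval x = p x - κ * x ^ (2 * F) * q x := fun x => by
    rw [hG, eval_pathDet_glue, Real.sq_sqrt hκ.le]
  -- window 2: `|l₂|` roots in `(x₂, x₁)`
  have halt₂' : (x₂ :: l₂).IsChain (fun x y => G.eval x * G.eval y < 0) := by
    refine (isChain_alt_congr (c := 1) (f := p) fun x hx => ?_).mp halt₂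
    rw [one_mul, hev x]
    have := hxs x (List.mem_toFinset.mpr (List.mem_append_left _ hx))
    linarith [this]
  have hW₂ := le_card_roots_window_of_isChain G x₁ l₂ x₂
    (List.IsChain.left_of_append (l₂ := [x₁]) (show ((x₂ :: l₂) ++ [x₁]).IsChain (· < ·) from hch2))
    (fun v hv => (hl₂x₁ v hv).le) halt₂'
  -- window 1: `|l₁| + 2` roots in `(x₁, σ)`
  have halt₁' : (x₁ :: (l₁ ++ [ρ, σ])).IsChain (fun x y => G.eval x * G.eval y < 0) := by
    rw [List.isChain_cons_split]
    constructor
    · refine (isChain_alt_congr (c := 1) (f := p) fun x hx => ?_).mp halt₁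
      rw [one_mul, hev x]
      have := hxs x (List.mem_toFinset.mpr (List.mem_append_right _ hx))
      linarith [this]
    · refine List.isChain_cons_cons.mpr ⟨?_, List.isChain_singleton _⟩
      rw [hev ρ, hev σ]
      have h1 := hxs ρ (List.mem_toFinset.mpr (by simp))
      have h2 := hys σ (Finset.mem_singleton_self σ)
      refine lt_of_not_ge fun H => ?_
      nlinarith [mul_pos (mul_pos h1 h2) (mul_pos hρσ hagree), mul_nonneg H (sq_nonneg (p ρ * p σ * q σ))]
  have hW₁ := le_card_roots_window_of_isChain G σ (l₁ ++ [ρ, σ]) x₁ hch1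
    (fun v hv => by
      rcases List.mem_append.mp hv with h | h
      · exact ((hbelowρ v (List.mem_cons_of_mem _ h)).trans hρσ').le
      · simp only [List.mem_cons, List.not_mem_nil, or_false] at h
        rcases h with rfl | rfl
        · exact hρσ'.le
        · exact le_rfl) halt₁'
  -- the two windows are disjoint sets of positive roots
  have hdisj : Disjoint (G.roots.toFinset.filter (fun t => x₂ < t ∧ t < x₁)) (G.roots.toFinset.filter (fun t => x₁ < t ∧ t < σ)) :=
    Finset.disjoint_filter.mpr fun t _ h2 h1 => lt_asymm h2.2 h1.1
  have hsub : G.roots.toFinset.filter (fun t => x₂ < t ∧ t < x₁) ∪ G.roots.toFinset.filter (fun t => x₁ < t ∧ t < σ) ⊆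
      G.roots.toFinset.filter (fun t => 0 < t) := by
    intro t ht
    rcases Finset.mem_union.mp ht with ht | ht
    · rw [Finset.mem_filter] at ht ⊢; exact ⟨ht.1, hx₂.trans ht.2.1⟩
    · rw [Finset.mem_filter] at ht ⊢; exact ⟨ht.1, hx₁.trans ht.2.1⟩
  have hcard := Finset.card_union_of_disjoint hdisj ▸ Finset.card_le_card hsub
  simp only [List.length_append, List.length_cons, List.length_nil] at hW₁
  omega

/-- **THE GLUE LAW WITHOUT THE TRANSITION (plain superadditivity, all sizes).**  If `p = N₁ · N₂` alternates in sign along the positive points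
`x₂ :: l₂` and along `x₁ :: l₁` (both with at least two points, all strictly increasing, `x₂ :: l₂` below `x₁`), then for some coupling exponent
`F` and some `β > 0` the glued design of size `n₁ + n₂ + 2` has at least `|l₂| + |l₁| = Z₂ + Z₁` distinct positive determinant zeros.
**`B(m₁ + m₂) ≥ Z₁ + Z₂`.** [this seat] -/
theorem glue_row_noTransition (n₁ n₂ : ℕ) (x₂ : ℝ) (l₂ : List ℝ) (hl₂ : l₂ ≠ []) (x₁ : ℝ) (l₁ : List ℝ) (hl₁ : l₁ ≠ [])
    (hchain : (x₂ :: l₂ ++ x₁ :: l₁).IsChain (· < ·)) (hx₂ : 0 < x₂)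
    (halt₂ : (x₂ :: l₂).IsChain (fun x y =>
      ((pathDet a₁ d₁ b₁ f₁ (n₁ + 1)).eval x * (pathDet a₂ d₂ b₂ f₂ (n₂ + 1)).eval x) *
        ((pathDet a₁ d₁ b₁ f₁ (n₁ + 1)).eval y * (pathDet a₂ d₂ b₂ f₂ (n₂ + 1)).eval y) < 0))
    (halt₁ : (x₁ :: l₁).IsChain (fun x y =>
      ((pathDet a₁ d₁ b₁ f₁ (n₁ + 1)).eval x * (pathDet a₂ d₂ b₂ f₂ (n₂ + 1)).eval x) *
        ((pathDet a₁ d₁ b₁ f₁ (n₁ + 1)).eval y * (pathDet a₂ d₂ b₂ f₂ (n₂ + 1)).eval y) < 0)) :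
    ∃ (F : ℕ) (β : ℝ), 0 < β ∧ l₂.length + l₁.length ≤
      ((pathDet (fun t => if t ≤ n₁ then a₁ t else a₂ (t - (n₁ + 1))) (fun t => if t ≤ n₁ then d₁ t else d₂ (t - (n₁ + 1)))
        (fun t => if t < n₁ then b₁ t else if t = n₁ then β else b₂ (t - (n₁ + 1)))
        (fun t => if t < n₁ then f₁ t else if t = n₁ then F else f₂ (t - (n₁ + 1))) (n₁ + n₂ + 2)).roots.toFinset.filter
          (fun t => 0 < t)).card := by
  set p : ℝ → ℝ := fun x => (pathDet a₁ d₁ b₁ f₁ (n₁ + 1)).eval x * (pathDet a₂ d₂ b₂ f₂ (n₂ + 1)).eval x with hp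
  set q : ℝ → ℝ := fun x => (pathDet a₁ d₁ b₁ f₁ n₁).eval x *
    (pathDet (fun t => a₂ (t + 1)) (fun t => d₂ (t + 1)) (fun t => b₂ (t + 1)) (fun t => f₂ (t + 1)) n₂).eval x with hq
  change (x₂ :: l₂).IsChain (fun x y => p x * p y < 0) at halt₂
  change (x₁ :: l₁).IsChain (fun x y => p x * p y < 0) at halt₁
  have hpw : (x₂ :: l₂ ++ x₁ :: l₁).Pairwise (· < ·) := List.isChain_iff_pairwise.mp hchain
  have hch1 : (x₁ :: l₁).IsChain (· < ·) := (List.isChain_split.mp hchain).2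
  have hch2 : (x₂ :: (l₂ ++ [x₁])).IsChain (· < ·) := (List.isChain_split.mp hchain).1
  have hl₂x₁ : ∀ v ∈ l₂, v < x₁ := fun v hv =>
    lt_last_of_isChain (show ((x₂ :: l₂) ++ [x₁]).IsChain (· < ·) from hch2) v (List.mem_cons_of_mem _ hv)
  have hx₂x₁ : x₂ < x₁ := lt_last_of_isChain (show ((x₂ :: l₂) ++ [x₁]).IsChain (· < ·) from hch2) x₂ (by simp)
  have hx₁ : 0 < x₁ := hx₂.trans hx₂x₁
  have hposall : ∀ v ∈ x₂ :: l₂ ++ x₁ :: l₁, 0 < v := by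
    intro v hv
    rcases List.mem_cons.mp hv with rfl | hv
    · exact hx₂
    · exact hx₂.trans (List.rel_of_pairwise_cons hpw hv)
  have hpne₂ : ∀ v ∈ x₂ :: l₂, p v ≠ 0 := by
    obtain ⟨y, l, rfl⟩ := List.exists_cons_of_ne_nil hl₂
    exact ne_zero_of_isChain_alt halt₂
  have hpne₁ : ∀ v ∈ x₁ :: l₁, p v ≠ 0 := by
    obtain ⟨y, l, rfl⟩ := List.exists_cons_of_ne_nil hl₁
    exact ne_zero_of_isChain_alt halt₁
  -- a common upper bound: the sum of the (positive) points
  set r₁ : ℝ := (x₂ :: l₂ ++ x₁ :: l₁).sum with hr₁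
  have hle : ∀ v ∈ x₂ :: l₂ ++ x₁ :: l₁, v ≤ r₁ := fun v hv =>
    List.single_le_sum (fun u hu => (hposall u hu).le) v hv
  have hr₁pos : 0 < r₁ := hx₂.trans_le (hle x₂ (by simp))
  obtain ⟨F, κ, hκ, hxs, -⟩ := exists_move_signs_sq p q (x₂ :: l₂ ++ x₁ :: l₁).toFinset ∅ hr₁pos (lt_add_one r₁)
    (fun x hx => by
      have hx' : x ∈ x₂ :: l₂ ++ x₁ :: l₁ := List.mem_toFinset.mp hx
      refine ⟨hposall x hx', hle x hx', ?_⟩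
      rcases List.mem_append.mp hx' with h | h
      · exact hpne₂ x h
      · exact hpne₁ x h)
    (fun y hy => by simp at hy)
  refine ⟨F, Real.sqrt κ, Real.sqrt_pos.mpr hκ, ?_⟩
  set G := pathDet (fun t => if t ≤ n₁ then a₁ t else a₂ (t - (n₁ + 1))) (fun t => if t ≤ n₁ then d₁ t else d₂ (t - (n₁ + 1)))
      (fun t => if t < n₁ then b₁ t else if t = n₁ then Real.sqrt κ else b₂ (t - (n₁ + 1)))
      (fun t => if t < n₁ then f₁ t else if t = n₁ then F else f₂ (t - (n₁ + 1))) (n₁ + n₂ + 2) with hG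
  have hev : ∀ x : ℝ, G.eval x = p x - κ * x ^ (2 * F) * q x := fun x => by
    rw [hG, eval_pathDet_glue, Real.sq_sqrt hκ.le]
  have halt₂' : (x₂ :: l₂).IsChain (fun x y => G.eval x * G.eval y < 0) := by
    refine (isChain_alt_congr (c := 1) (f := p) fun x hx => ?_).mp halt₂
    rw [one_mul, hev x]
    have := hxs x (List.mem_toFinset.mpr (List.mem_append_left _ hx))
    linarith [this]
  have halt₁' : (x₁ :: l₁).IsChain (fun x y => G.eval x * G.eval y < 0) := by
    refine (isChain_alt_congr (c := 1) (f := p) fun x hx => ?_).mp halt₁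
    rw [one_mul, hev x]
    have := hxs x (List.mem_toFinset.mpr (List.mem_append_right _ hx))
    linarith [this]
  have hW₂ := le_card_roots_window_of_isChain G x₁ l₂ x₂
    (List.IsChain.left_of_append (l₂ := [x₁]) (show ((x₂ :: l₂) ++ [x₁]).IsChain (· < ·) from hch2))
    (fun v hv => (hl₂x₁ v hv).le) halt₂'
  have hW₁ := le_card_roots_window_of_isChain G r₁ l₁ x₁ hch1
    (fun v hv => hle v (List.mem_append_right _ (List.mem_cons_of_mem _ hv))) halt₁'
  have hdisj : Disjoint (G.roots.toFinset.filter (fun t => x₂ < t ∧ t < x₁)) (G.roots.toFinset.filter (fun t => x₁ < t ∧ t < r₁)) :=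
    Finset.disjoint_filter.mpr fun t _ h2 h1 => lt_asymm h2.2 h1.1
  have hsub : G.roots.toFinset.filter (fun t => x₂ < t ∧ t < x₁) ∪ G.roots.toFinset.filter (fun t => x₁ < t ∧ t < r₁) ⊆
      G.roots.toFinset.filter (fun t => 0 < t) := by
    intro t ht
    rcases Finset.mem_union.mp ht with ht | ht
    · rw [Finset.mem_filter] at ht ⊢; exact ⟨ht.1, hx₂.trans ht.2.1⟩
    · rw [Finset.mem_filter] at ht ⊢; exact ⟨ht.1, hx₁.trans ht.2.1⟩
  have hcard := Finset.card_union_of_disjoint hdisj ▸ Finset.card_le_card hsub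
  omega

end GlueRow

end Summit.ValiantsHypothesis.ValiantsHypothesis.Theorems.KPlusLogSqLaw.StaticTridiagonalRealGlue
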